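import Summits.MatrixMultiplication.Statement
import Summits.MatrixMultiplication.MatrixMultiplication.Theorems.AsymptoticSpectrumOmegaGeTwo

/-!
# MatrixMultiplication / GroupTheoreticSTPP — assembly (hypothesis form) and bookkeeping

Route `MatrixMultiplication/GroupTheoreticSTPP`. Thesis X_C (stmt-MatrixMultiplication-0593): for
every `ε > 0` some finite abelian group carries a simultaneous-triple-product-property (STPP)
construction `(Aᵢ, Bᵢ, Cᵢ)` (Cohn–Kleinberg–Szegedy–Umans 2005, Def. 5.1; written additively and
inlined) with `|H| < ∑ᵢ (|Aᵢ||Bᵢ||Cᵢ|)^{(2+ε)/3}`.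

* The filed assembly stmt-0594 (`X_C → MatrixMultiplication`) silently uses the CKSU fundamental
  inequality `∑ᵢ (|Aᵢ||Bᵢ||Cᵢ|)^{ω/3} ≤ |H|` (CKSU 2005, Thm. 5.5, abelian case), which is a deep
  theorem not in the tree; `matrixMultiplication_of_cksu_of_thesis` is the honest hypothesis form,
  with the inequality as an explicit premise in the item's own inlined spelling. Choosing
  `ε := ω − 2` makes the exponents match exactly, so no monotonicity in the exponent is needed.
* `neg_crux_iff_not_thesis`: the negative crux stmt-0596 is literally `¬ X_C`.
-/

namespace MatrixMultiplication.GroupTheoreticSTPP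

open Finset

/-- Hypothesis-form assembly for route GroupTheoreticSTPP: the CKSU fundamental inequality
(Cohn–Kleinberg–Szegedy–Umans 2005, Thm. 5.5, abelian case: STPP ⇒ `∑ᵢ (|Aᵢ||Bᵢ||Cᵢ|)^{ω/3} ≤ |H|`)
together with the thesis X_C (stmt-MatrixMultiplication-0593, verbatim) gives `ω(ℂ) = 2`:
if `ω > 2`, apply X_C with `ε = ω − 2` and compare with the inequality; `ω ≥ 2` is
`two_le_omega`. Recommended re-signature of stmt-MatrixMultiplication-0594. [folklore] -/
theorem matrixMultiplication_of_cksu_of_thesis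
    (hCKSU : ∀ (H : Type) [AddCommGroup H] [Fintype H] (N : ℕ) (A B C : Fin N → Finset H),
      (∀ i j k : Fin N, ∀ s ∈ A k, ∀ s' ∈ A i, ∀ t ∈ B i, ∀ t' ∈ B j, ∀ u ∈ C j, ∀ u' ∈ C k, (s' - s) + (t' - t) + (u' - u) = 0 → i = j ∧ j = k ∧ s = s' ∧ t = t' ∧ u = u') →
      ∑ i, (((A i).card * (B i).card * (C i).card : ℕ) : ℝ) ^ (Literature.Computability.AlgebraicComplexity.omega ℂ / 3) ≤ (Fintype.card H : ℝ))
    (hX : ∀ ε : ℝ, 0 < ε → ∃ (H : Type) (_ : AddCommGroup H) (_ : Fintype H) (N : ℕ) (A B C : Fin N → Finset H), (∀ i j k : Fin N, ∀ s ∈ A k, ∀ s' ∈ A i, ∀ t ∈ B i, ∀ t' ∈ B j, ∀ u ∈ C j, ∀ u' ∈ C k, (s' - s) + (t' - t) + (u' - u) = 0 → i = j ∧ j = k ∧ s = s' ∧ t = t' ∧ u = u') ∧ (Fintype.card H : ℝ) < ∑ i, (((A i).card * (B i).card * (C i).card : ℕ) : ℝ) ^ ((2 + ε) / 3)) :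
    MatrixMultiplication := by
  rw [MatrixMultiplication_iff]
  by_contra hne
  have h2 : (2 : ℝ) < Literature.Computability.AlgebraicComplexity.omega ℂ := lt_of_le_of_ne (Literature.CplxAlg.two_le_omega ℂ) (Ne.symm hne)
  obtain ⟨H, _, _, N, A, B, C, hS, hlt⟩ := hX (Literature.Computability.AlgebraicComplexity.omega ℂ - 2) (sub_pos.mpr h2)
  have hle := hCKSU H N A B C hS
  rw [show (2 + (Literature.Computability.AlgebraicComplexity.omega ℂ - 2)) / 3 = Literature.Computability.AlgebraicComplexity.omega ℂ / 3 by ring] at hlt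
  exact lt_irrefl _ (hlt.trans_le hle)

/-- Bookkeeping: the negative crux stmt-MatrixMultiplication-0596 (a uniform `ε > 0` for which every
abelian STPP construction obeys `∑ᵢ (|Aᵢ||Bᵢ||Cᵢ|)^{(2+ε)/3} ≤ |H|`, i.e. BCCGNSU 2017 Thm. B
without the bounded-exponent hypothesis) is LITERALLY the negation of the thesis stmt-0593. So the
route is decided by exactly one of the two items. [folklore] -/
theorem neg_crux_iff_not_thesis :
    (∃ ε : ℝ, 0 < ε ∧ ∀ (H : Type) [AddCommGroup H] [Fintype H] (N : ℕ) (A B C : Fin N → Finset H), (∀ i j k : Fin N, ∀ s ∈ A k, ∀ s' ∈ A i, ∀ t ∈ B i, ∀ t' ∈ B j, ∀ u ∈ C j, ∀ u' ∈ C k, (s' - s) + (t' - t) + (u' - u) = 0 → i = j ∧ j = k ∧ s = s' ∧ t = t' ∧ u = u') → ∑ i, (((A i).card * (B i).card * (C i).card : ℕ) : ℝ) ^ ((2 + ε) / 3) ≤ (Fintype.card H : ℝ)) ↔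
    ¬ (∀ ε : ℝ, 0 < ε → ∃ (H : Type) (_ : AddCommGroup H) (_ : Fintype H) (N : ℕ) (A B C : Fin N → Finset H), (∀ i j k : Fin N, ∀ s ∈ A k, ∀ s' ∈ A i, ∀ t ∈ B i, ∀ t' ∈ B j, ∀ u ∈ C j, ∀ u' ∈ C k, (s' - s) + (t' - t) + (u' - u) = 0 → i = j ∧ j = k ∧ s = s' ∧ t = t' ∧ u = u') ∧ (Fintype.card H : ℝ) < ∑ i, (((A i).card * (B i).card * (C i).card : ℕ) : ℝ) ^ ((2 + ε) / 3)) := by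
  constructor
  · rintro ⟨ε, hε, h⟩ hX
    obtain ⟨H, _, _, N, A, B, C, hS, hlt⟩ := hX ε hε
    exact lt_irrefl _ (hlt.trans_le (h H N A B C hS))
  · intro h
    by_contra hneg
    apply h
    intro ε hε
    by_contra hex
    apply hneg
    refine ⟨ε, hε, fun H _ _ N A B C hS => ?_⟩
    by_contra hle
    exact hex ⟨H, ‹_›, ‹_›, N, A, B, C, hS, lt_of_not_ge hle⟩

end MatrixMultiplication.GroupTheoreticSTPP
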